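import Summits.BirchSwinnertonDyer.Rank1Residual.Additive.JValuationOfIntModel
import Literature.NumberTheory.PAdicHodge.DeRhamEllipticAbove
import Literature.NumberTheory.PAdicHodge.EisensteinRootShortModel
import Mathlib.NumberTheory.NumberField.Basic
import Mathlib.RingTheory.Polynomial.GaussLemma
import HarnessLib

/-!
# Crux K★ `StarredOptimalManinUnitFiveSeven` (stmt-BirchSwinnertonDyer-22226), line `kato-lever`, stub hDR on the three
# potentially SUPERSINGULAR cells `(5; IV*)`, `(5; II*)`, `(7; III*)`: the GOOD 𝒪_D-MODELS and the DESCENT —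
# hDRss ⟸ ONE displayed statement, the ramified good-supersingular capstone for `𝒪_D`-models

Cell `pub/bsd-wall`, seat `bsd-line-edix-p1` g16 (unit (R1-MD) MODEL + DESCENT of memo `Lines/kato-lever-hDR-ss-assembly.md` v1.1 §4–4b).
TOOL theorems only (no definition, no named fact, no `sorry`, no instance); `--supports` 22226; nothing closed; BSD is not proved by this.

WHAT. `…CellsOfSL2NeronValues.starredOptimalManinUnitFiveSeven_of_sl2NeronValues_of_isDeRham_supersingularCells` proves K★ BY NAME
granted P1, hT₂ and the binder `hDRss` = de Rham-ness of `V_pW|_{Γ_{ℚ_v}}` on the three potentially supersingular starred cells.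
There `W` acquires good SUPERSINGULAR reduction over `K' = ℚ(p^{1/e})`, `e = 3, 6, 4`, through the explicit model
`W_D = ⟨0, 0, 0, −27(c₄/p^m)·ϱ^{r₄}, −54(c₆/p^n)·ϱ^{r₆}⟩` over `𝒪_D = ℤ_p[X]/(X^e − p)` (`ϱ` the class of `X`;
`(e; m, n; r₄, r₆) = (3; 3, 4; 1, 0), (6; 4, 5; 4, 0), (4; 3, 5; 0, 2)`), with unit discriminant `−6¹²·Δ_min/p^{ord_p Δ_min}`,
reduction `y² = x³ + b̄` (`j̃ = 0`, at `5`) resp. `y² = x³ + āx` (`j̃ = 1728`, at `7`) — supersingular, defined over `𝔽_p`, of exact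
height `2` over any residue field — and `K'`-isomorphic to `W ×_ℚ K'` (`exists_variableChange_eq_short`, `u = p^{k/e}/6`).
* §1 helpers: `irreducible_X_pow_sub_C_rat`, `charP_residueField_of_valuation_lt_one`, `p^{⌈v/3⌉} ∣ c₄`, `p^{⌈v/2⌉} ∣ c₆` from
  `ord_p j ≥ 0`, the unit identity `64(−27A)³p^{t₄} + 432(−54B)²p^{t₆} = −6¹²·d`.
* §2 **`isDeRham_adicCompletion_rat_of_model_of_ramifiedCapstone`** — hDR at `ℚ_v` ⟸ the displayed statement `hR` = the expected
  RAMIFIED CAPSTONE «for every `p`-adic `F`, Eisenstein datum `D`, `W₀` over `K₀ ⊆ F` with `W₀ ×_{K₀} F = W_D ⊗ F`, `W_D` over `𝒪_D`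
  with unit `Δ` whose reduction along every `𝒪_D → 𝓀_F` is supersingular of exact height `2`: `V_pW₀|_{Γ_F}` is de Rham» (the
  `𝒪_D`-analogue of `Literature.NumberTheory.PAdicHodge.isDeRham_restrictedRationalTateRep_of_goodSupersingular`, to be assembled from
  the (R1) ring `AinfRamified*` and the transcribed period files); descent by `DeRhamEllipticAbove`.
* §3 **`isDeRham_supersingularCells_of_ramifiedCapstone`** — `hDRss` VERBATIM ⟸ `hR`;
  **`starredOptimalManinUnitFiveSeven_of_sl2NeronValues_of_ramifiedCapstone`** — the route decl K★ BY NAME ⟸ {P1, hT₂, `hR`}.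
HONEST STATUS: conditional (P1, hT₂ cite-only XL; `hR` not yet a tree theorem); K★ stays OPEN ⟸ {P1, hT₂, hR}.
References: [SilvermanAEC2009] III.1, VII.5.5, IV.7.5; [SerreLocalFields1979] I §6; [Fontaine1982FormesDifferentielles] §5; [BrinonConrad2009] 6.3.8.
-/

set_option autoImplicit false
-- the Theorems namespace of a single-conjunct summit repeats the summit name by design (D-0017)
set_option linter.dupNamespace false

noncomputable section

open scoped Classical NumberField

open Polynomial WeierstrassCurve NumberField IsDedekindDomain Field ValuativeRel
  Literature.NumberTheory.EllipticCurves Literature.NumberTheory.EllipticCurves.ModularForms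
  Literature.NumberTheory.EllipticCurves.Rank1Residual Literature.NumberTheory.EllipticCurves.Kato2004
  Literature.NumberTheory.DiophantineGeometry Rat.HeightOneSpectrum
  Literature.NumberTheory.PAdicHodge Literature.NumberTheory.GaloisRepresentations
  Literature.NumberTheory.GaloisRepresentations.IsNonarchimedeanLocalField
  Summit.BirchSwinnertonDyer.Rank1Residual.Additive

namespace Summit.BirchSwinnertonDyer.BirchSwinnertonDyer.Theorems.StarredOptimalManinUnitFiveSevenSupersingularCellsModels

/-! ## §1 Helpers: `ℚ(p^{1/e})`, residue characteristic, divisibilities, the unit identity -/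

/-- **`X^e − p` is irreducible over `ℚ`** (`e ≥ 1`, `p` prime): Eisenstein at `p` in `ℤ[X]`, then Gauss's lemma.
[cite: SerreLocalFields1979, Ch. I §6 Prop. 17] -/
theorem irreducible_X_pow_sub_C_rat {e : ℕ} (he : 0 < e) {p : ℕ} (hp : p.Prime) :
    Irreducible (X ^ e - C (p : ℚ) : ℚ[X]) := by
  have hf : (X ^ e - C (p : ℤ) : ℤ[X]).Monic := monic_X_pow_sub_C _ he.ne'
  have hfd : (X ^ e - C (p : ℤ) : ℤ[X]).natDegree = e := natDegree_X_pow_sub_C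
  have hP' : Prime (p : ℤ) := Nat.prime_iff_prime_int.mp hp
  have hP : (Ideal.span {(p : ℤ)}).IsPrime := (Ideal.span_singleton_prime hP'.ne_zero).mpr hP'
  have hE : (X ^ e - C (p : ℤ) : ℤ[X]).IsEisensteinAt (Ideal.span {(p : ℤ)}) := by
    refine hf.isEisensteinAt_of_mem_of_notMem hP.ne_top ?_ ?_
    · intro n hn
      rw [hfd] at hn
      rw [coeff_sub, coeff_X_pow, if_neg hn.ne, coeff_C, zero_sub, Ideal.neg_mem_iff]
      split_ifs
      · exact Ideal.mem_span_singleton_self _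
      · exact Ideal.zero_mem _
    · rw [coeff_sub, coeff_X_pow, if_neg he.ne, coeff_C_zero, zero_sub, Ideal.neg_mem_iff, Ideal.span_singleton_pow,
        Ideal.mem_span_singleton]
      intro h
      have h1 : (p : ℤ) ^ 2 ∣ (p : ℤ) ^ 1 := by rwa [pow_one]
      have := (pow_dvd_pow_iff hP'.ne_zero hP'.not_unit).1 h1
      omega
  have hirr : Irreducible (X ^ e - C (p : ℤ) : ℤ[X]) := hE.irreducible hP hf.isPrimitive (by rw [hfd]; exact he)
  have hQ := (IsPrimitive.Int.irreducible_iff_irreducible_map_cast hf.isPrimitive).1 hirr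
  simpa using hQ

/-- The residue field of a `p`-adic field (`|p| < 1`) has characteristic `p`. [cite: SerreLocalFields1979, Ch. II §5] -/
theorem charP_residueField_of_valuation_lt_one {F : Type} [Field F] [ValuativeRel F] [TopologicalSpace F]
    [IsNonarchimedeanLocalField F] {p : ℕ} [Fact p.Prime] (hp : valuation F p < 1) : CharP 𝓀[F] p := by
  refine (CharP.charP_iff_prime_eq_zero Fact.out).2 ?_
  rw [← map_natCast (IsLocalRing.residue 𝒪[F]), IsLocalRing.residue_eq_zero_iff, IsLocalRing.mem_maximalIdeal,
    mem_nonunits_iff, (Valuation.integer.integers (valuation F)).isUnit_iff_valuation_eq_one]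
  rw [map_natCast]
  exact hp.ne

/-- Every rational prime lies below some finite place of a number field (private plumbing). [folklore] -/
private theorem exists_place (K : Type) [Field K] [NumberField K] {p : ℕ} (hp : p.Prime) :
    ∃ w : HeightOneSpectrum (𝓞 K), (p : 𝓞 K) ∈ w.asIdeal := by
  haveI : (Ideal.span {(p : ℤ)}).IsMaximal :=
    Ideal.IsPrime.isMaximal (Ideal.span_singleton_prime (by exact_mod_cast hp.ne_zero) |>.2
      (Nat.prime_iff_prime_int.1 hp)) (by
        rw [Ne, Ideal.span_singleton_eq_bot]; exact_mod_cast hp.ne_zero)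
  obtain ⟨Q, hQmax, hQ⟩ := Ideal.exists_ideal_over_maximal_of_isIntegral (S := 𝓞 K)
    (Ideal.span {(p : ℤ)}) (by
      rw [(RingHom.injective_iff_ker_eq_bot _).1 (algebraMap ℤ (𝓞 K)).injective_int]; exact bot_le)
  have hpQ : (p : 𝓞 K) ∈ Q := by
    have : (p : ℤ) ∈ Q.comap (algebraMap ℤ (𝓞 K)) := hQ ▸ Ideal.mem_span_singleton_self _
    simpa using this
  refine ⟨⟨Q, hQmax.isPrime, fun h => ?_⟩, hpQ⟩
  rw [h] at hpQ
  have : (p : 𝓞 K) = 0 := hpQ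
  exact hp.ne_zero (by exact_mod_cast this)

/-- **The number field `K' = ℚ[X]/(X^e − p) = ℚ(p^{1/e})`**: for `e ≥ 1` and `p` prime there are a number field `K'`, an
`α ∈ K'` with `α^e = p`, and a place `v'` of `K'` above `p`. [cite: SerreLocalFields1979, Ch. I §6 Prop. 17] -/
theorem exists_numberField_pow_eq_prime {e : ℕ} (he : 0 < e) {p : ℕ} (hp : p.Prime) :
    ∃ (K' : Type) (_ : Field K') (_ : NumberField K') (α : K') (v' : HeightOneSpectrum (𝓞 K')),
      α ^ e = (p : K') ∧ (p : 𝓞 K') ∈ v'.asIdeal := by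
  haveI : Fact (Irreducible (X ^ e - C (p : ℚ) : ℚ[X])) := ⟨irreducible_X_pow_sub_C_rat he hp⟩
  set f : ℚ[X] := X ^ e - C (p : ℚ) with hf
  obtain ⟨v', hv'⟩ := exists_place (AdjoinRoot f) hp
  refine ⟨AdjoinRoot f, inferInstance, inferInstance, AdjoinRoot.root f, v', ?_, hv'⟩
  have h : Polynomial.eval₂ (AdjoinRoot.of f) (AdjoinRoot.root f) (X ^ e - C (p : ℚ)) = 0 := AdjoinRoot.eval₂_root f
  rw [eval₂_sub, eval₂_X_pow, eval₂_C, map_natCast, sub_eq_zero] at h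
  exact h

variable (W : WeierstrassCurve ℚ) [W.IsElliptic] [W.IsGloballyMinimal] (p : ℕ) [hp : Fact p.Prime]

/-- **`p^m ∣ c₄(W_min)` whenever `3m ≤ ord_p Δ_min + 2` and `ord_p j ≥ 0`** (`j = c₄³/Δ`, so `3·ord_p c₄ ≥ ord_p Δ_min`).
[cite: SilvermanAEC2009, VII.5.5] -/
theorem pow_dvd_c₄_of_padicValRat_j_nonneg (hj : 0 ≤ padicValRat p W.j) {m : ℕ}
    (hm : 3 * m ≤ padicValInt p W.minimalDiscriminantInt + 2) : (p : ℤ) ^ m ∣ (integralModelInt W).c₄ := by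
  by_cases hc : (integralModelInt W).c₄ = 0
  · rw [hc]; exact dvd_zero _
  have h := padicValRat_j_eq_of_intModel (W := W) rfl p hc
  have hΔ : padicValInt p (integralModelInt W).Δ = padicValInt p W.minimalDiscriminantInt := rfl
  rw [padicValInt_dvd_iff]
  right
  have : (padicValInt p W.minimalDiscriminantInt : ℤ) ≤ 3 * (padicValInt p (integralModelInt W).c₄ : ℤ) := by
    rw [← hΔ]; linarith
  omega

/-- **`p^n ∣ c₆(W_min)` whenever `2n ≤ ord_p Δ_min + 1` and `ord_p j ≥ 0`** (`c₆² = c₄³ − 1728Δ`, any prime `p`).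
[cite: SilvermanAEC2009, III.1 and VII.5.5] -/
theorem pow_dvd_c₆_of_padicValRat_j_nonneg (hj : 0 ≤ padicValRat p W.j) {n : ℕ}
    (hn : 2 * n ≤ padicValInt p W.minimalDiscriminantInt + 1) : (p : ℤ) ^ n ∣ (integralModelInt W).c₆ := by
  set V := integralModelInt W with hV
  set v := padicValInt p W.minimalDiscriminantInt with hv
  have hpr : p.Prime := hp.out
  -- `p^v ∣ c₄³`
  have h4 : (p : ℤ) ^ v ∣ V.c₄ ^ 3 := by
    by_cases hc : V.c₄ = 0
    · rw [hc, zero_pow three_ne_zero]; exact dvd_zero _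
    have h := padicValRat_j_eq_of_intModel (W := W) rfl p hc
    have hΔ : padicValInt p (integralModelInt W).Δ = v := rfl
    have hle : v ≤ 3 * padicValInt p V.c₄ := by
      have : (v : ℤ) ≤ 3 * (padicValInt p (integralModelInt W).c₄ : ℤ) := by rw [← hΔ]; linarith
      exact_mod_cast this
    have hc4 : (p : ℤ) ^ padicValInt p V.c₄ ∣ V.c₄ := (padicValInt_dvd_iff _ _).2 (Or.inr le_rfl)
    exact (pow_dvd_pow _ hle).trans (by rw [pow_mul']; exact pow_dvd_pow_of_dvd hc4 3)
  -- `p^v ∣ Δ`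
  have hΔ : (p : ℤ) ^ v ∣ V.Δ := (padicValInt_dvd_iff _ _).2 (Or.inr le_rfl)
  -- `c₆² = c₄³ − 1728 Δ`
  have hrel : V.c₆ ^ 2 = V.c₄ ^ 3 - 1728 * V.Δ := by have := V.c_relation; linarith
  have h6sq : (p : ℤ) ^ v ∣ V.c₆ ^ 2 := by rw [hrel]; exact dvd_sub h4 (dvd_mul_of_dvd_right hΔ _)
  by_cases hc6 : V.c₆ = 0
  · rw [hc6]; exact dvd_zero _
  rw [padicValInt_dvd_iff]
  right
  have h2 : v ≤ padicValInt p (V.c₆ ^ 2) := by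
    rcases (padicValInt_dvd_iff _ _).1 h6sq with h | h
    · exact absurd (pow_eq_zero_iff two_ne_zero |>.1 h) hc6
    · exact h
  rw [pow_two, padicValInt.mul hc6 hc6] at h2
  omega

omit [W.IsElliptic] [W.IsGloballyMinimal] hp in
/-- **The unit identity**: from `p^m A = c₄`, `p^n B = c₆`, `p^v d = Δ`, `1728Δ = c₄³ − c₆²`, `3m = v + t₄`, `2n = v + t₆`:
`64(−27A)³p^{t₄} + 432(−54B)²p^{t₆} = −6¹²·d` (the discriminant of the rescaled short model is `6¹²Δ/u¹²`).
[cite: SilvermanAEC2009, III.1 (Table 3.1)] -/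
theorem unit_identity {c₄ c₆ Dm A B d : ℤ} {q : ℤ} (hq : q ≠ 0) {m n v t₄ t₆ : ℕ} (hA : q ^ m * A = c₄) (hB : q ^ n * B = c₆)
    (hd : q ^ v * d = Dm) (hrel : 1728 * Dm = c₄ ^ 3 - c₆ ^ 2) (hm : 3 * m = v + t₄) (hn : 2 * n = v + t₆) :
    64 * (-27 * A) ^ 3 * q ^ t₄ + 432 * (-54 * B) ^ 2 * q ^ t₆ = -(6 ^ 12 * d) := by
  have h3 : c₄ ^ 3 = q ^ v * (q ^ t₄ * A ^ 3) := by
    rw [← hA, mul_pow, ← pow_mul, show m * 3 = v + t₄ by omega, pow_add]; ring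
  have h2 : c₆ ^ 2 = q ^ v * (q ^ t₆ * B ^ 2) := by
    rw [← hB, mul_pow, ← pow_mul, show n * 2 = v + t₆ by omega, pow_add]; ring
  have key : q ^ v * (1728 * d - (q ^ t₄ * A ^ 3 - q ^ t₆ * B ^ 2)) = 0 := by
    have : 1728 * (q ^ v * d) = q ^ v * (q ^ t₄ * A ^ 3) - q ^ v * (q ^ t₆ * B ^ 2) := by rw [hd, hrel, h3, h2]
    linear_combination this
  have hv0 : q ^ v ≠ 0 := pow_ne_zero _ hq
  have h0 : 1728 * d - (q ^ t₄ * A ^ 3 - q ^ t₆ * B ^ 2) = 0 := (mul_eq_zero.1 key).resolve_left hv0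
  linear_combination (1259712 : ℤ) * h0

/-! ## §2 hDR at `ℚ_v` from the 𝒪_D-model, granted the ramified capstone -/

section Capstone

-- `hR`: the expected ramified good-supersingular capstone for `𝒪_D`-models (analogue of `isDeRham_restrictedRationalTateRep_of_goodSupersingular`)
variable
  (hR : ∀ {F : Type} [Field F] [ValuativeRel F] [TopologicalSpace F] [IsNonarchimedeanLocalField F] [CharZero F]
    {p : ℕ} [Fact p.Prime] [Fact (¬ IsUnit (p : integerC F))] [IsAdicComplete (Ideal.span {(p : integerC F)}) (integerC F)]
    (hp : valuation F p < 1) [Algebra ℚ_[p] F] (D : EisensteinRoot F p hp)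
    {K₀ : Type} [Field K₀] [CharZero K₀] [Algebra K₀ F] (W₀ : WeierstrassCurve K₀) [W₀.IsElliptic]
    (WD : WeierstrassCurve D.Coeff),
    W₀.baseChange F = WD.map (EisensteinRoot.Coeff.toF D) → 5 ≤ p → IsUnit WD.Δ →
    (∀ γ : D.Coeff →+* 𝓀[F], (WD.map γ).hasseCoeff p = 0 ∧ PowerSeries.coeff (p ^ 2) ((WD.map γ).formalMul p) ≠ 0) →
    GaloisRep.IsDeRham (bdRPeriodRingData (F := F) (p := p) hp) (restrictedRationalTateRep W₀ F p))

include hR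

/-- **hDR at `ℚ_v` from the explicit 𝒪_D-model, GRANTED the ramified capstone `hR`.** For `W/ℚ` globally minimal, `p ∈ {5, 7}`,
`ord_p j(W) ≥ 0`, a number field `K' ∋ α` with `α^e = p`, a place `v' ∣ p` of `K'`, and numerology `(e, k, m, n, r₄, r₆, t₄, t₆)`
(`e m = 4k + r₄`, `e n = 6k + r₆`, `3r₄ = e t₄`, `2r₆ = e t₆`, `3m = ord_p Δ_min + t₄`, `2n = ord_p Δ_min + t₆`, `t₄ ≤ 2`, `t₆ ≤ 1`,
`r₄ > 0` if `p = 5`, `r₆ > 0` if `p = 7`): `V_pW|_{Γ_{ℚ_v}}` is de Rham. Proof: `F = K'_{v'}`, `ϖ = α`, `D = (X^e − p, ϖ)`,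
`S = ⟨0,0,0,−27c₄/α^{4k},−54c₆/α^{6k}⟩ ≅ W ×_ℚ K'` (`u = α^k/6`), `S ×_{K'} F = W_D ⊗ F`, `Δ(W_D)` a unit, reduction supersingular
of exact height `2`; `hR` gives hDR for `S` at `F`; isogeny invariance + Brinon–Conrad descend it to `W` at `ℚ_v`.
[cite: SilvermanAEC2009, VII.5.5 and IV.7.5] [cite: Fontaine1982FormesDifferentielles, §5] [cite: BrinonConrad2009, Prop. 6.3.8] -/
theorem isDeRham_adicCompletion_rat_of_model_of_ramifiedCapstone (hp57 : p = 5 ∨ p = 7) (hj : 0 ≤ padicValRat p W.j)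
    {e k m n r₄ r₆ t₄ t₆ : ℕ} (he : 0 < e) (hem : e * m = 4 * k + r₄) (hen : e * n = 6 * k + r₆)
    (h₄ : 3 * r₄ = e * t₄) (h₆ : 2 * r₆ = e * t₆)
    (hm : 3 * m = padicValInt p W.minimalDiscriminantInt + t₄) (hn : 2 * n = padicValInt p W.minimalDiscriminantInt + t₆)
    (ht₄ : t₄ ≤ 2) (ht₆ : t₆ ≤ 1) (hr₄ : p = 5 → 0 < r₄) (hr₆ : p = 7 → 0 < r₆)
    {K' : Type} [Field K'] [NumberField K'] {α : K'} (hαe : α ^ e = (p : K'))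
    (v' : HeightOneSpectrum (𝓞 K')) (hv' : (p : 𝓞 K') ∈ v'.asIdeal)
    (v : HeightOneSpectrum (𝓞 ℚ)) (hpv : (p : 𝓞 ℚ) ∈ v.asIdeal)
    [CharZero (v.adicCompletion ℚ)] [Fact (¬ IsUnit (p : integerC (v.adicCompletion ℚ)))]
    [IsAdicComplete (Ideal.span {(p : integerC (v.adicCompletion ℚ))}) (integerC (v.adicCompletion ℚ))]
    (hp' : valuation (v.adicCompletion ℚ) p < 1) [Algebra ℚ_[p] (v.adicCompletion ℚ)] :
    GaloisRep.IsDeRham (bdRPeriodRingData (F := v.adicCompletion ℚ) (p := p) hp')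
      (restrictedRationalTateRep W (v.adicCompletion ℚ) p) := by
  have hpr : p.Prime := hp.out
  have hp5 : 5 ≤ p := by rcases hp57 with rfl | rfl <;> norm_num
  set V := integralModelInt W with hV
  set vΔ := padicValInt p W.minimalDiscriminantInt with hvΔ
  obtain ⟨A, hA⟩ := pow_dvd_c₄_of_padicValRat_j_nonneg W p hj (m := m) (by omega)
  obtain ⟨B, hB⟩ := pow_dvd_c₆_of_padicValRat_j_nonneg W p hj (n := n) (by omega)
  have hΔ0 : V.Δ ≠ 0 := minimalDiscriminantInt_ne_zero W
  obtain ⟨d, hd⟩ : (p : ℤ) ^ vΔ ∣ V.Δ := (padicValInt_dvd_iff _ _).2 (Or.inr le_rfl)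
  have hpd : ¬ (p : ℤ) ∣ d := by
    rintro ⟨d', rfl⟩
    have : (p : ℤ) ^ (vΔ + 1) ∣ V.Δ := ⟨d', by rw [hd, pow_succ]; ring⟩
    rcases (padicValInt_dvd_iff _ _).1 this with h | h
    · exact hΔ0 h
    · have h' : vΔ + 1 ≤ vΔ := h
      omega
  have hunit : IsUnit (64 * (-27 * (A : ℤ_[p])) ^ 3 * (p : ℤ_[p]) ^ t₄ + 432 * (-54 * (B : ℤ_[p])) ^ 2 * (p : ℤ_[p]) ^ t₆) := by
    have hid := unit_identity (q := (p : ℤ)) (by exact_mod_cast hpr.ne_zero) hA.symm hB.symm hd.symm V.c_relation hm hn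
    have hz : ¬ (p : ℤ) ∣ -(6 ^ 12 * d) := by
      rw [dvd_neg]
      intro h
      rcases (Nat.prime_iff_prime_int.mp hpr).dvd_or_dvd h with h6 | h6
      · have hp6 : (p : ℤ) ∣ 6 := Int.Prime.dvd_pow' hpr h6
        rcases hp57 with rfl | rfl <;> norm_num at hp6
      · exact hpd h6
    have hu : IsUnit (((-(6 ^ 12 * d) : ℤ)) : ℤ_[p]) := by
      rw [PadicInt.isUnit_iff]
      exact le_antisymm (PadicInt.norm_le_one _) (not_lt.1 fun h => hz ((PadicInt.norm_int_lt_one_iff_dvd _).1 h))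
    rw [← hid] at hu
    push_cast at hu
    exact hu
  have hα0 : α ≠ 0 := by
    intro h0; rw [h0, zero_pow he.ne'] at hαe; exact (Nat.cast_ne_zero.2 hpr.ne_zero) hαe.symm
  -- the `K'`-model `S ≅ W ×_ℚ K'`
  set S : WeierstrassCurve K' :=
    ⟨0, 0, 0, -27 * (V.c₄ : K') / (α ^ k) ^ 4, -54 * (V.c₆ : K') / (α ^ k) ^ 6⟩ with hS
  have hWK' : W.baseChange K' = V.map (Int.castRingHom K') := by
    rw [WeierstrassCurve.baseChange, ← map_integralModelInt W, WeierstrassCurve.map_map]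
    congr 1
    exact RingHom.ext_int _ _
  have hc4K : (W.baseChange K').c₄ = (V.c₄ : K') := by rw [hWK', WeierstrassCurve.map_c₄, eq_intCast]
  have hc6K : (W.baseChange K').c₆ = (V.c₆ : K') := by rw [hWK', WeierstrassCurve.map_c₆, eq_intCast]
  have h6 : (6 : K') ≠ 0 := by norm_num
  obtain ⟨C, hC⟩ := exists_variableChange_eq_short (L := K') two_ne_zero three_ne_zero (W.baseChange K')
    (u := α ^ k / 6) (div_ne_zero (pow_ne_zero _ hα0) h6)
  have e4 : -(V.c₄ : K') / (48 * (α ^ k / 6) ^ 4) = -27 * (V.c₄ : K') / (α ^ k) ^ 4 := by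
    have : (α ^ k) ≠ 0 := pow_ne_zero _ hα0
    field_simp
    ring
  have e6 : -(V.c₆ : K') / (864 * (α ^ k / 6) ^ 6) = -54 * (V.c₆ : K') / (α ^ k) ^ 6 := by
    have : (α ^ k) ≠ 0 := pow_ne_zero _ hα0
    field_simp
    ring
  have hC' : C • W.baseChange K' = S := by rw [hC, hS, hc4K, hc6K, e4, e6]
  haveI : S.IsElliptic := hC' ▸ (inferInstance : (C • W.baseChange K').IsElliptic)
  have hiso : IsIsogenous (W.baseChange K') S := isIsogenous_of_smul_eq hC'
  refine isDeRham_restrictedRationalTateRep_adicCompletion_rat_of_isDeRham_isogenous_above W v' hv' S hiso ?_ v hpv hp'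
  -- hDR for `S` at `F = K'_{v'}` from the capstone
  intro _ _ _ hpF _
  obtain ⟨ϖ, hϖ⟩ : ∃ ϖ : v'.adicCompletion K', ϖ = algebraMap K' (v'.adicCompletion K') α := ⟨_, rfl⟩
  have hϖe : ϖ ^ e = (p : v'.adicCompletion K') := by rw [hϖ, ← map_pow, hαe, map_natCast]
  have hϖ0 : ϖ ≠ 0 := by rw [hϖ]; exact (_root_.map_ne_zero _).2 hα0
  obtain ⟨D, hDpoly, hDroot⟩ := EisensteinRoot.exists_poly_eq_X_pow_sub_C hpF he hϖe
  have hroot := D.root_pow_eq_of_poly_eq hDpoly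
  haveI : CharP 𝓀[v'.adicCompletion K'] p := charP_residueField_of_valuation_lt_one hpF
  have hunit' : IsUnit (64 * (((-27 * A : ℤ) : ℤ_[p])) ^ 3 * (p : ℤ_[p]) ^ t₄ +
      432 * (((-54 * B : ℤ) : ℤ_[p])) ^ 2 * (p : ℤ_[p]) ^ t₆) := by
    push_cast
    exact hunit
  have hΔD := isUnit_Δ_model hroot ((-27 * A : ℤ) : ℤ_[p]) ((-54 * B : ℤ) : ℤ_[p]) h₄ h₆ hunit'
  refine hR hpF D S
    ⟨0, 0, 0, AdjoinRoot.of D.poly ((-27 * A : ℤ) : ℤ_[p]) * AdjoinRoot.root D.poly ^ r₄,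
      AdjoinRoot.of D.poly ((-54 * B : ℤ) : ℤ_[p]) * AdjoinRoot.root D.poly ^ r₆⟩ ?_ hp5 hΔD ?_
  · -- `S ×_{K'} F = W_D ⊗ F`
    rw [map_model_toF, hDroot]
    have hp4 : (ϖ ^ k) ^ 4 * ϖ ^ r₄ = (p : v'.adicCompletion K') ^ m := by
      rw [← pow_mul, ← pow_add, show k * 4 + r₄ = e * m by omega, pow_mul, hϖe]
    have hp6 : (ϖ ^ k) ^ 6 * ϖ ^ r₆ = (p : v'.adicCompletion K') ^ n := by
      rw [← pow_mul, ← pow_add, show k * 6 + r₆ = e * n by omega, pow_mul, hϖe]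
    have hc4F : ((V.c₄ : ℤ) : v'.adicCompletion K') = (ϖ ^ k) ^ 4 * ϖ ^ r₄ * (A : v'.adicCompletion K') := by
      rw [hp4, hA]; push_cast; ring
    have hc6F : ((V.c₆ : ℤ) : v'.adicCompletion K') = (ϖ ^ k) ^ 6 * ϖ ^ r₆ * (B : v'.adicCompletion K') := by
      rw [hp6, hB]; push_cast; ring
    have hϖk : ϖ ^ k ≠ 0 := pow_ne_zero _ hϖ0
    have ha4 : algebraMap K' (v'.adicCompletion K') (-27 * (V.c₄ : K') / (α ^ k) ^ 4) =
        zpToF hpF ((-27 * A : ℤ) : ℤ_[p]) * ϖ ^ r₄ := by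
      rw [map_div₀, map_mul, map_neg, map_ofNat, map_intCast, map_pow, map_pow, ← hϖ, map_intCast, hc4F]
      field_simp
      push_cast
      ring
    have ha6 : algebraMap K' (v'.adicCompletion K') (-54 * (V.c₆ : K') / (α ^ k) ^ 6) =
        zpToF hpF ((-54 * B : ℤ) : ℤ_[p]) * ϖ ^ r₆ := by
      rw [map_div₀, map_mul, map_neg, map_ofNat, map_intCast, map_pow, map_pow, ← hϖ, map_intCast, hc6F]
      field_simp
      push_cast
      ring
    exact WeierstrassCurve.ext (map_zero _) (map_zero _) (map_zero _) ha4 ha6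
  · -- supersingular reduction of exact height `2` along every `γ : 𝒪_D → 𝓀_F`
    intro γ
    have hA0 : (WeierstrassCurve.map (⟨0, 0, 0, AdjoinRoot.of D.poly ((-27 * A : ℤ) : ℤ_[p]) * AdjoinRoot.root D.poly ^ r₄,
        AdjoinRoot.of D.poly ((-54 * B : ℤ) : ℤ_[p]) * AdjoinRoot.root D.poly ^ r₆⟩ : WeierstrassCurve D.Coeff) γ).hasseCoeff p
        = 0 := by
      rcases hp57 with rfl | rfl
      · exact hasseCoeff_map_model_five_eq_zero hroot _ _ (hr₄ rfl) _ γ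
      · exact hasseCoeff_map_model_seven_eq_zero hroot _ _ _ (hr₆ rfl) γ
    exact ⟨hA0, coeff_sq_formalMul_map_model_ne_zero hp5 hroot _ _ _ _ γ (Δ_map_ne_zero_of_isUnit _ hΔD γ) hA0⟩

end Capstone

end Summit.BirchSwinnertonDyer.BirchSwinnertonDyer.Theorems.StarredOptimalManinUnitFiveSevenSupersingularCellsModels

end
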